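import Literature.NumberTheory.Weil1964.ArchUnitarySiegelDomain
import HarnessLib

/-!
# The Siegel embedding of `U(α, β)`: `toSp(G) ⋆ Φ(Z) = Φ(G·Z)` and the factorisation of Folland's automorphy factor

Topic `NumberTheory/Weil1964`; namespace `Literature.NumberTheory.Weil1964.UnitaryBall`.  KERNEL throughout
(definitions with bodies and proved theorems only).  Sequel of `ArchUnitarySiegelDomain`.

The tree realises `U(α, β)` inside weil-1's `Sp(W)`, `W = ℝ^{α⊕β} × ℝ^{α⊕β}`, by the twisted realification
`UForm.toSp` (`KonnoKonno2007.RealUnitaryDualPair`: `z = p + iq ↦ tw(G · tw z)`, `tw` = conjugation of the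
`α`-coordinates), and `Sp(W)` acts on the Siegel half-space through the Schrödinger-model generators,
`g ⋆ τ = (𝐃τ − 𝐂)(𝐀 − 𝐁τ)⁻¹` with automorphy factor `j(g, τ) = det(𝐀 − 𝐁τ)` (`ArchSiegelGaussianAction`).  This file
computes that action on the image of the Cayley–Satake map `Φ(Z) = i(1 − Ẑ)(1 + Ẑ)⁻¹` of `ArchUnitarySiegelDomain`:

* §3 the real blocks of `toSp G`: `𝐀 = Re G`, `𝐁 = −(Im G)E`, `𝐂 = E(Im G)`, `𝐃 = E(Re G)E`, `E = diag(−1_α, 1_β)`;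
  hence `denom(toSp G, τ) = Re G + (Im G)Eτ`, `numer(toSp G, τ) = E(Re G)Eτ − E(Im G)`;
* §4 with `B₁ = (0 Z; 0 1)`, `B₂ = (1 0; Zᵀ 0)` (so `1 + Ẑ = B₁ + B₂`, `E(1 − Ẑ) = B₁ − B₂`):
  `denom · (1 + Ẑ) = G B₁ + Ḡ B₂ = (1 + Ẑ′) · F` and `numer · (1 + Ẑ) = iE(G B₁ − Ḡ B₂) = i(1 − Ẑ′) · F`, where
  `Z′ = G·Z`, `F = diag((a + bZᴴ)ᴴᵀ, cZ + d)` (the frame identity of `ArchUnitaryBallFrame` and the isotropy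
  identity, read in the Lagrangian `{(p, −Φ(Z)p)}` of the Gaussian `e^{πi yΦ(Z)y}`); consequently
  - **EQUIVARIANCE** `toSp(G) ⋆ Φ(Z) = Φ(G·Z)` (`sact_toSp_Φ`),
  - **FACTORISATION** `j(toSp G, Φ Z) · det(1 − iΦ(G·Z)) = conj(det(a + bZᴴ)) · det(cZ + d) · det(1 − iΦ(Z))`
    (`sJ_toSp_Φ`; the Cayley factors `det(1 + Ẑ)`, `det(1 + Ẑ′)` cancel against `det(1 − iΦ) det(1 + Ẑ) = 2ⁿ`).

The factor `det(1 − iτ)` is exactly the square of the vacuum overlap `⟪h₀, e^{πi yτy}⟫` up to `2^{n/2}`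
(`ArchGaussianFourier`), so the factorisation says: the VACUUM-NORMALISED Gaussian multiplier of a metaplectic element
over `toSp G` has square `1/(conj det(a + bZᴴ) · det(cZ + d))` at `Φ(Z)` — the input of
`ArchMetaplecticUnitaryDetCharacter`.  Source of the construction: [Satake1965] (equivariant holomorphic embedding of
the bounded domain of `U(p,q)` into the Siegel space); canonical automorphy factors as in [Lee2004, §6.3].

## References

* [Satake1965] I. Satake, *Holomorphic imbeddings of symmetric domains into a Siegel space*, Amer. J. Math. 87 (1965).
* [Lee2004] M. H. Lee, *Mixed Automorphic Forms, Torus Bundles, and Jacobi Forms*, LNM 1845 (2004), §6.3 (6.27)–(6.30).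
* [Folland1989] G. B. Folland, *Harmonic Analysis in Phase Space*, Princeton UP 1989, §4.1 Prop. (4.1), (4.6); §4.5.
-/

set_option autoImplicit false

noncomputable section

open Matrix Complex
open scoped ComplexOrder ComplexConjugate

namespace Literature.NumberTheory.Weil1964

open Literature.RepresentationTheory.KonnoKonno2007 Literature.RepresentationTheory.KonnoKonno2007.RealDualPair
open Literature.NumberTheory.Automorphic Literature.NumberTheory.Automorphic.UnitaryGroup
open Literature.Analysis.SegalBargmann

namespace UnitaryBall

variable {α β : Type*} [Fintype α] [DecidableEq α] [Fintype β] [DecidableEq β]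

/-- complexification of a real matrix of size `α ⊕ β` -/
local notation "RC" => RingHom.mapMatrix (m := α ⊕ β) Complex.ofRealHom

/-! ## 3. The real blocks of `toSp G` and the complexified denominator / numerator -/

section Blocks

omit [Fintype α] [DecidableEq α] [Fintype β] [DecidableEq β] in
/-- Real part and the twist: `Re (tw w)_k = Re w_k`. [cite: Folland1989, §4.1 Prop. (4.6)] -/
private theorem re_tw (w : α ⊕ β → ℂ) (k : α ⊕ β) : (tw w k).re = (w k).re := by
  rcases k with a | b
  · rw [tw_inl, Complex.star_def, Complex.conj_re]
  · rw [tw_inr]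

/-- The sign vector `ε = (−1 on α, +1 on β)` of the twist. [cite: Folland1989, §4.1 Prop. (4.6)] -/
def sgnR : α ⊕ β → ℝ := Sum.elim (fun _ => -1) (fun _ => 1)

/-- The real sign matrix `E = diag(−1_α, 1_β)`. [cite: Folland1989, §4.1 Prop. (4.6)] -/
def realE : Matrix (α ⊕ β) (α ⊕ β) ℝ := Matrix.diagonal sgnR

omit [Fintype α] [DecidableEq α] [Fintype β] [DecidableEq β] in
/-- Imaginary part and the twist: `Im (tw w)_k = ε_k Im w_k`. [cite: Folland1989, §4.1 Prop. (4.6)] -/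
private theorem im_tw (w : α ⊕ β → ℂ) (k : α ⊕ β) : (tw w k).im = sgnR k * (w k).im := by
  rcases k with a | b
  · rw [tw_inl, Complex.star_def, Complex.conj_im, sgnR, Sum.elim_inl, neg_one_mul]
  · rw [tw_inr, sgnR, Sum.elim_inr, one_mul]

omit [Fintype α] [DecidableEq α] [Fintype β] [DecidableEq β] in
/-- `tw (p + i·0) = p` for real `p`. [cite: Folland1989, §4.1 Prop. (4.6)] -/
private theorem tw_phasePt_fst (p : α ⊕ β → ℝ) : tw (phasePt p 0) = fun j => (p j : ℂ) := by
  funext j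
  rcases j with a | b
  · rw [tw_inl, phasePt_apply, Pi.zero_apply, Complex.ofReal_zero, zero_mul, add_zero, Complex.star_def,
      Complex.conj_ofReal]
  · rw [tw_inr, phasePt_apply, Pi.zero_apply, Complex.ofReal_zero, zero_mul, add_zero]

/-- `tw (0 + i·q) = i · (Eq)` for real `q`. [cite: Folland1989, §4.1 Prop. (4.6)] -/
private theorem tw_phasePt_snd (q : α ⊕ β → ℝ) :
    tw (phasePt 0 q) = I • fun j => (((realE *ᵥ q) j : ℝ) : ℂ) := by
  funext j
  rw [Pi.smul_apply, smul_eq_mul, realE, Matrix.mulVec_diagonal]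
  rcases j with a | b
  · rw [tw_inl, phasePt_apply, Pi.zero_apply, Complex.ofReal_zero, zero_add, Complex.star_def, map_mul,
      Complex.conj_ofReal, Complex.conj_I, sgnR, Sum.elim_inl]
    push_cast
    ring
  · rw [tw_inr, phasePt_apply, Pi.zero_apply, Complex.ofReal_zero, zero_add, sgnR, Sum.elim_inr, one_mul, mul_comm]

omit [DecidableEq α] [DecidableEq β] in
/-- `Re (M p)_k = (Re M) p` for a real vector `p`. [folklore] -/
private theorem re_mulVec_ofReal (M : Matrix (α ⊕ β) (α ⊕ β) ℂ) (p : α ⊕ β → ℝ) (k : α ⊕ β) :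
    ((M *ᵥ fun j => (p j : ℂ)) k).re = (M.map Complex.re *ᵥ p) k := by
  simp [Matrix.mulVec, dotProduct, Complex.re_sum, Matrix.map_apply]

omit [DecidableEq α] [DecidableEq β] in
/-- `Im (M p)_k = (Im M) p` for a real vector `p`. [folklore] -/
private theorem im_mulVec_ofReal (M : Matrix (α ⊕ β) (α ⊕ β) ℂ) (p : α ⊕ β → ℝ) (k : α ⊕ β) :
    ((M *ᵥ fun j => (p j : ℂ)) k).im = (M.map Complex.im *ᵥ p) k := by
  simp [Matrix.mulVec, dotProduct, Complex.im_sum, Matrix.map_apply]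

/-- **The block `𝐀` of `toSp G` is `Re G`.** [cite: Folland1989, §4.1 Prop. (4.1), Prop. (4.6)] -/
theorem mA_toSp (G : UForm α β) : Sp.mA (UForm.toSp α β G) = (mat G).map Complex.re := by
  refine Matrix.ext_iff_mulVec.2 fun p => funext fun k => ?_
  rw [Sp.mA_mulVec, UForm.coe_toSp]
  change (twMulVec (mat G) (phasePt p 0) k).re = _
  rw [twMulVec, re_tw, tw_phasePt_fst, re_mulVec_ofReal]

/-- **The block `𝐂` of `toSp G` is `E · Im G`.** [cite: Folland1989, §4.1 Prop. (4.1), Prop. (4.6)] -/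
theorem mC_toSp (G : UForm α β) : Sp.mC (UForm.toSp α β G) = realE * (mat G).map Complex.im := by
  refine Matrix.ext_iff_mulVec.2 fun p => funext fun k => ?_
  rw [Sp.mC_mulVec, UForm.coe_toSp]
  change (twMulVec (mat G) (phasePt p 0) k).im = _
  rw [twMulVec, im_tw, tw_phasePt_fst, im_mulVec_ofReal, ← Matrix.mulVec_mulVec, realE, Matrix.mulVec_diagonal]

/-- **The block `𝐁` of `toSp G` is `−(Im G) · E`.** [cite: Folland1989, §4.1 Prop. (4.1), Prop. (4.6)] -/
theorem mB_toSp (G : UForm α β) : Sp.mB (UForm.toSp α β G) = -((mat G).map Complex.im * realE) := by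
  refine Matrix.ext_iff_mulVec.2 fun q => funext fun k => ?_
  rw [Sp.mB_mulVec, UForm.coe_toSp]
  change (twMulVec (mat G) (phasePt 0 q) k).re = _
  rw [twMulVec, re_tw, tw_phasePt_snd, Matrix.mulVec_smul, Pi.smul_apply, smul_eq_mul, Complex.I_mul_re,
    im_mulVec_ofReal, Matrix.neg_mulVec, Pi.neg_apply, ← Matrix.mulVec_mulVec]

/-- **The block `𝐃` of `toSp G` is `E · Re G · E`.** [cite: Folland1989, §4.1 Prop. (4.1), Prop. (4.6)] -/
theorem mD_toSp (G : UForm α β) : Sp.mD (UForm.toSp α β G) = realE * (mat G).map Complex.re * realE := by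
  refine Matrix.ext_iff_mulVec.2 fun q => funext fun k => ?_
  rw [Sp.mD_mulVec, UForm.coe_toSp]
  change (twMulVec (mat G) (phasePt 0 q) k).im = _
  rw [twMulVec, im_tw, tw_phasePt_snd, Matrix.mulVec_smul, Pi.smul_apply, smul_eq_mul, Complex.I_mul_im,
    re_mulVec_ofReal, ← Matrix.mulVec_mulVec, ← Matrix.mulVec_mulVec, realE, Matrix.mulVec_diagonal]

/-- **The complex sign matrix `E = diag(−1_α, 1_β)`.** [cite: Folland1989, §4.1 Prop. (4.6)] -/
def Ec : Matrix (α ⊕ β) (α ⊕ β) ℂ := Matrix.fromBlocks (-1) 0 0 1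

/-- `RC E = Ec`. [cite: Folland1989, §4.1 Prop. (4.6)] -/
theorem RC_realE : RC (realE : Matrix (α ⊕ β) (α ⊕ β) ℝ) = (Ec : Matrix (α ⊕ β) (α ⊕ β) ℂ) := by
  ext (i | i) (j | j)
  · by_cases h : i = j
    · subst h; simp [realE, Ec, sgnR]
    · simp [realE, Ec, sgnR, h]
  · simp [realE, Ec]
  · simp [realE, Ec]
  · by_cases h : i = j
    · subst h; simp [realE, Ec, sgnR]
    · simp [realE, Ec, sgnR, h]

/-- **`denom(toSp G, τ) = Re G + (Im G) E τ`.** [cite: Folland1989, §4.5 (4.64)] -/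
theorem denom_toSp (G : UForm α β) (τ : Matrix (α ⊕ β) (α ⊕ β) ℂ) :
    Sp.denom (UForm.toSp α β G) τ = RC ((mat G).map Complex.re) + RC ((mat G).map Complex.im) * Ec * τ := by
  rw [Sp.denom, mA_toSp, mB_toSp, map_neg, map_mul, RC_realE, Matrix.neg_mul, sub_neg_eq_add]

/-- **`numer(toSp G, τ) = E (Re G) E τ − E (Im G)`.** [cite: Folland1989, §4.5 (4.64)] -/
theorem numer_toSp (G : UForm α β) (τ : Matrix (α ⊕ β) (α ⊕ β) ℂ) :
    Sp.numer (UForm.toSp α β G) τ = Ec * RC ((mat G).map Complex.re) * Ec * τ - Ec * RC ((mat G).map Complex.im) := by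
  rw [Sp.numer, mD_toSp, mC_toSp, map_mul, map_mul, map_mul, RC_realE]

/-- `Re G + i Im G = G`. [folklore] -/
private theorem RC_re_add (M : Matrix (α ⊕ β) (α ⊕ β) ℂ) :
    RC (M.map Complex.re) + I • RC (M.map Complex.im) = M := by
  ext i j
  simp only [Matrix.add_apply, Matrix.smul_apply, RingHom.mapMatrix_apply, Matrix.map_apply, smul_eq_mul,
    Complex.ofRealHom_eq_coe]
  apply Complex.ext <;> simp

/-- `Re G − i Im G = Ḡ = Gᴴᵀ` (entrywise conjugate). [folklore] -/
private theorem RC_re_sub (M : Matrix (α ⊕ β) (α ⊕ β) ℂ) :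
    RC (M.map Complex.re) - I • RC (M.map Complex.im) = Mᴴᵀ := by
  ext i j
  simp only [Matrix.sub_apply, Matrix.smul_apply, RingHom.mapMatrix_apply, Matrix.map_apply, smul_eq_mul,
    Complex.ofRealHom_eq_coe, Matrix.transpose_apply, Matrix.conjTranspose_apply, Complex.star_def]
  apply Complex.ext <;> simp

end Blocks

/-! ## 4. Equivariance and the factorisation of `j(toSp G, Φ(Z))` -/

section Algebra

omit [DecidableEq α] [DecidableEq β] in
/-- `R(B₁ + B₂) + i J(B₁ − B₂) = (R + iJ)B₁ + (R − iJ)B₂`. [folklore] -/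
private theorem alg₁ (R J B₁ B₂ : Matrix (α ⊕ β) (α ⊕ β) ℂ) :
    R * (B₁ + B₂) + I • (J * (B₁ - B₂)) = (R + I • J) * B₁ + (R - I • J) * B₂ := by
  simp only [Matrix.mul_add, Matrix.add_mul, Matrix.mul_sub, Matrix.sub_mul, Matrix.smul_mul, smul_sub]
  abel

omit [DecidableEq α] [DecidableEq β] in
/-- `i E R(B₁ − B₂) − E J(B₁ + B₂) = i E((R + iJ)B₁ − (R − iJ)B₂)`. [folklore] -/
private theorem alg₂ (E R J B₁ B₂ : Matrix (α ⊕ β) (α ⊕ β) ℂ) :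
    I • (E * R * (B₁ - B₂)) - E * J * (B₁ + B₂) = I • (E * ((R + I • J) * B₁ - (R - I • J) * B₂)) := by
  simp only [Matrix.mul_add, Matrix.add_mul, Matrix.mul_sub, Matrix.sub_mul, Matrix.smul_mul, Matrix.mul_smul,
    smul_add, smul_sub, smul_smul, I_mul_I, neg_one_smul, Matrix.mul_assoc]
  abel

end Algebra

/-- `1 + Ẑ = B₁ + B₂` and `E(1 − Ẑ) = B₁ − B₂` with `B₁ = (0 Z; 0 1)`, `B₂ = (1 0; Zᵀ 0)`. [cite: Lee2004, §6.3] -/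
private theorem hatZ_split (Z : Matrix α β ℂ) :
    (1 : Matrix (α ⊕ β) (α ⊕ β) ℂ) + hatZ Z = Matrix.fromBlocks 0 Z 0 1 + Matrix.fromBlocks 1 0 Zᵀ 0 ∧
      Ec * ((1 : Matrix (α ⊕ β) (α ⊕ β) ℂ) - hatZ Z) = Matrix.fromBlocks 0 Z 0 1 - Matrix.fromBlocks 1 0 Zᵀ 0 := by
  constructor
  · rw [hatZ, ← Matrix.fromBlocks_one, Matrix.fromBlocks_add, Matrix.fromBlocks_add]
    simp
  · rw [hatZ, ← Matrix.fromBlocks_one, Ec, sub_eq_add_neg, sub_eq_add_neg, Matrix.fromBlocks_neg,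
      Matrix.fromBlocks_neg, Matrix.fromBlocks_add, Matrix.fromBlocks_add, Matrix.fromBlocks_multiply]
    simp

/-- `G · B₁ = (0 aZ+b; 0 cZ+d)`. [cite: Lee2004, §6.3 (6.30)] -/
private theorem mat_mul_B₁ (G : UForm α β) (Z : Matrix α β ℂ) :
    mat G * Matrix.fromBlocks 0 Z 0 1 = Matrix.fromBlocks 0 (a G * Z + b G) 0 (c G * Z + d G) := by
  rw [mat_eq_fromBlocks, Matrix.fromBlocks_multiply]
  simp

/-- `Ḡ · B₂ = (X 0; Z′ᵀX 0)` with `X = (a + bZᴴ)ᴴᵀ`, `Z′ = G·Z` (the isotropy identity, conjugated).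
[cite: Lee2004, §6.3 (6.30)] -/
private theorem conj_mat_mul_B₂ (G : UForm α β) {Z : Matrix α β ℂ} (hZ : Z ∈ ball α β) :
    (mat G)ᴴᵀ * Matrix.fromBlocks 1 0 Zᵀ 0 =
      Matrix.fromBlocks (a G + b G * Zᴴ)ᴴᵀ 0 ((moebius G Z)ᵀ * (a G + b G * Zᴴ)ᴴᵀ) 0 := by
  have hiso : (c G + d G * Zᴴ)ᴴᵀ = (moebius G Z)ᵀ * (a G + b G * Zᴴ)ᴴᵀ := by
    rw [c_add_d_mul_conjTranspose G hZ, Matrix.conjTranspose_mul, Matrix.conjTranspose_conjTranspose,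
      Matrix.transpose_mul]
  have hab : (a G + b G * Zᴴ)ᴴᵀ = (a G)ᴴᵀ + (b G)ᴴᵀ * Zᵀ := by
    rw [Matrix.conjTranspose_add, Matrix.conjTranspose_mul, Matrix.conjTranspose_conjTranspose, Matrix.transpose_add,
      Matrix.transpose_mul]
  have hcd : (c G + d G * Zᴴ)ᴴᵀ = (c G)ᴴᵀ + (d G)ᴴᵀ * Zᵀ := by
    rw [Matrix.conjTranspose_add, Matrix.conjTranspose_mul, Matrix.conjTranspose_conjTranspose, Matrix.transpose_add,
      Matrix.transpose_mul]
  rw [← hiso, hab, hcd, mat_eq_fromBlocks, Matrix.fromBlocks_conjTranspose, Matrix.fromBlocks_transpose,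
    Matrix.fromBlocks_multiply]
  simp

/-- **The frame map** `F = diag((a + bZᴴ)ᴴᵀ, cZ + d)` of the Lagrangian frames (entrywise conjugate on the
antiholomorphic block). [cite: Lee2004, §6.3 (6.30)] -/
def frameF (G : UForm α β) (Z : Matrix α β ℂ) : Matrix (α ⊕ β) (α ⊕ β) ℂ :=
  Matrix.fromBlocks (a G + b G * Zᴴ)ᴴᵀ 0 0 (c G * Z + d G)

/-- `det F = conj(det(a + bZᴴ)) · det(cZ + d)`. [cite: Lee2004, §6.3 (6.30)] -/
theorem det_frameF (G : UForm α β) (Z : Matrix α β ℂ) :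
    (frameF G Z).det = star (a G + b G * Zᴴ).det * (c G * Z + d G).det := by
  rw [frameF, Matrix.det_fromBlocks_zero₂₁, Matrix.det_transpose, Matrix.det_conjTranspose]

/-- `det F ≠ 0` on the domain. [cite: Lee2004, §6.3 (6.30)] -/
theorem det_frameF_ne_zero (G : UForm α β) {Z : Matrix α β ℂ} (hZ : Z ∈ ball α β) : (frameF G Z).det ≠ 0 := by
  rw [det_frameF]
  exact mul_ne_zero (star_ne_zero.2 (det_ab_ne_zero G hZ)) (det_cd_ne_zero G hZ)

/-- **The denominator identity** `denom(toSp G, Φ Z) · (1 + Ẑ) = (1 + Ẑ′) · F`, `Z′ = G·Z`: the frame identity of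
`ArchUnitaryBallFrame` read through the Lagrangian `{(p, −Φ(Z)p)}` of the Gaussian `e^{πi yΦ(Z)y}`.
[cite: Lee2004, §6.3 (6.27)–(6.30)] -/
theorem denom_toSp_Φ_mul (G : UForm α β) {Z : Matrix α β ℂ} (hZ : Z ∈ ball α β) :
    Sp.denom (UForm.toSp α β G) (Φ Z) * (1 + hatZ Z) = (1 + hatZ (moebius G Z)) * frameF G Z := by
  obtain ⟨hN, hEK⟩ := hatZ_split Z
  obtain ⟨hN₁, -⟩ := hatZ_split (moebius G Z)
  have hsplit : Sp.denom (UForm.toSp α β G) (Φ Z) * (1 + hatZ Z) =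
      mat G * Matrix.fromBlocks 0 Z 0 1 + (mat G)ᴴᵀ * Matrix.fromBlocks 1 0 Zᵀ 0 := by
    have e : RC ((mat G).map Complex.im) * Ec * Φ Z * (1 + hatZ Z) =
        I • (RC ((mat G).map Complex.im) * (Ec * (1 - hatZ Z))) := by
      rw [Matrix.mul_assoc (RC ((mat G).map Complex.im) * Ec), Φ_mul_one_add_hatZ hZ, Matrix.mul_smul,
        Matrix.mul_assoc]
    rw [denom_toSp, Matrix.add_mul, e, hEK, hN, alg₁, RC_re_add, RC_re_sub]
  rw [hsplit, mat_mul_B₁, conj_mat_mul_B₂ G hZ, Matrix.fromBlocks_add, hN₁, frameF, Matrix.add_mul,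
    Matrix.fromBlocks_multiply, Matrix.fromBlocks_multiply, Matrix.fromBlocks_add, moebius_mul_cd G hZ]
  simp

/-- **The numerator identity** `numer(toSp G, Φ Z) · (1 + Ẑ) = i(1 − Ẑ′) · F`. [cite: Lee2004, §6.3 (6.27)–(6.30)] -/
theorem numer_toSp_Φ_mul (G : UForm α β) {Z : Matrix α β ℂ} (hZ : Z ∈ ball α β) :
    Sp.numer (UForm.toSp α β G) (Φ Z) * (1 + hatZ Z) = (I • (1 - hatZ (moebius G Z))) * frameF G Z := by
  obtain ⟨hN, hEK⟩ := hatZ_split Z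
  have hsplit : Sp.numer (UForm.toSp α β G) (Φ Z) * (1 + hatZ Z) =
      I • (Ec * (mat G * Matrix.fromBlocks 0 Z 0 1 - (mat G)ᴴᵀ * Matrix.fromBlocks 1 0 Zᵀ 0)) := by
    have e : Ec * RC ((mat G).map Complex.re) * Ec * Φ Z * (1 + hatZ Z) =
        I • (Ec * RC ((mat G).map Complex.re) * (Ec * (1 - hatZ Z))) := by
      rw [Matrix.mul_assoc (Ec * RC ((mat G).map Complex.re) * Ec), Φ_mul_one_add_hatZ hZ, Matrix.mul_smul,
        Matrix.mul_assoc (Ec * RC ((mat G).map Complex.re))]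
    rw [numer_toSp, Matrix.sub_mul, e, hEK, hN, alg₂, RC_re_add, RC_re_sub]
  have hK₁ : (1 : Matrix (α ⊕ β) (α ⊕ β) ℂ) - hatZ (moebius G Z) =
      Matrix.fromBlocks 1 (-moebius G Z) (-(moebius G Z)ᵀ) 1 := by
    rw [hatZ, ← Matrix.fromBlocks_one, sub_eq_add_neg, Matrix.fromBlocks_neg, Matrix.fromBlocks_add]
    simp
  rw [hsplit, mat_mul_B₁, conj_mat_mul_B₂ G hZ, hK₁, frameF, Matrix.smul_mul, Matrix.fromBlocks_multiply, Ec,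
    ← moebius_mul_cd G hZ]
  congr 1
  rw [sub_eq_add_neg, Matrix.fromBlocks_neg, Matrix.fromBlocks_add, Matrix.fromBlocks_multiply]
  simp

/-- **Equivariance**: `toSp(G) ⋆ Φ(Z) = Φ(G·Z)` — `Φ` intertwines the Möbius action of `U(α,β)` on its bounded domain
with the action of `Sp(W)` on the Siegel half-space. [cite: Satake1965, §3; Lee2004, §6.3] -/
theorem sact_toSp_Φ (G : UForm α β) {Z : Matrix α β ℂ} (hZ : Z ∈ ball α β) :
    Sp.sact (UForm.toSp α β G) (Φ Z) = Φ (moebius G Z) := by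
  have hZ₁ := moebius_mem G hZ
  have hN : IsUnit (1 + hatZ Z).det := (Matrix.isUnit_iff_isUnit_det _).1 (isUnit_one_add_hatZ hZ)
  have hden : IsUnit (Sp.denom (UForm.toSp α β G) (Φ Z)).det := Sp.isUnit_det_denom _ (Φ_mem_siegelH hZ)
  -- `Φ(Z′) · denom = numer`, tested after right multiplication by the invertible `1 + Ẑ`
  have key : Φ (moebius G Z) * Sp.denom (UForm.toSp α β G) (Φ Z) = Sp.numer (UForm.toSp α β G) (Φ Z) := by
    have h : Φ (moebius G Z) * Sp.denom (UForm.toSp α β G) (Φ Z) * (1 + hatZ Z) =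
        Sp.numer (UForm.toSp α β G) (Φ Z) * (1 + hatZ Z) := by
      rw [Matrix.mul_assoc, denom_toSp_Φ_mul G hZ, ← Matrix.mul_assoc, Φ_mul_one_add_hatZ hZ₁, numer_toSp_Φ_mul G hZ]
    calc Φ (moebius G Z) * Sp.denom (UForm.toSp α β G) (Φ Z)
        = Φ (moebius G Z) * Sp.denom (UForm.toSp α β G) (Φ Z) * (1 + hatZ Z) * (1 + hatZ Z)⁻¹ := by
          rw [Matrix.mul_nonsing_inv_cancel_right _ _ hN]
      _ = Sp.numer (UForm.toSp α β G) (Φ Z) := by rw [h, Matrix.mul_nonsing_inv_cancel_right _ _ hN]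
  rw [Sp.sact, ← key, Matrix.mul_nonsing_inv_cancel_right _ _ hden]

/-- **`j(toSp G, Φ Z) · det(1 + Ẑ) = det(1 + Ẑ′) · conj(det(a + bZᴴ)) · det(cZ + d)`.** [cite: Lee2004, §6.3 (6.30)] -/
theorem sJ_toSp_Φ_mul_det (G : UForm α β) {Z : Matrix α β ℂ} (hZ : Z ∈ ball α β) :
    Sp.sJ (UForm.toSp α β G) (Φ Z) * (1 + hatZ Z).det =
      (1 + hatZ (moebius G Z)).det * (star (a G + b G * Zᴴ).det * (c G * Z + d G).det) := by
  rw [Sp.sJ, ← Matrix.det_mul, denom_toSp_Φ_mul G hZ, Matrix.det_mul, det_frameF]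

/-- **The factorisation of Folland's automorphy factor along `Φ`** (the Cayley factors `det(1 + Ẑ)` cancel
against `det(1 − iΦ)`):
`j(toSp G, Φ Z) · det(1 − iΦ(G·Z)) = conj(det(a + bZᴴ)) · det(cZ + d) · det(1 − iΦ(Z))`.
[cite: Lee2004, §6.3 (6.30); Folland1989, §4.5 (4.65)] -/
theorem sJ_toSp_Φ (G : UForm α β) {Z : Matrix α β ℂ} (hZ : Z ∈ ball α β) :
    Sp.sJ (UForm.toSp α β G) (Φ Z) * (1 - I • Φ (moebius G Z)).det =
      star (a G + b G * Zᴴ).det * (c G * Z + d G).det * (1 - I • Φ Z).det := by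
  have hZ₁ := moebius_mem G hZ
  have h0 := det_one_sub_I_smul_Φ_mul_det hZ       -- d₀ n₀ = 2ⁿ
  have h1 := det_one_sub_I_smul_Φ_mul_det hZ₁      -- d₁ n₁ = 2ⁿ
  have h := sJ_toSp_Φ_mul_det G hZ                  -- sJ n₀ = n₁ detF
  have h2n : (2 : ℂ) ^ Fintype.card (α ⊕ β) ≠ 0 := pow_ne_zero _ two_ne_zero
  apply mul_right_cancel₀ h2n
  calc Sp.sJ (UForm.toSp α β G) (Φ Z) * (1 - I • Φ (moebius G Z)).det * 2 ^ Fintype.card (α ⊕ β)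
      = (Sp.sJ (UForm.toSp α β G) (Φ Z) * (1 + hatZ Z).det) *
          ((1 - I • Φ (moebius G Z)).det * (1 - I • Φ Z).det) := by rw [← h0]; ring
    _ = star (a G + b G * Zᴴ).det * (c G * Z + d G).det * (1 - I • Φ Z).det *
          ((1 - I • Φ (moebius G Z)).det * (1 + hatZ (moebius G Z)).det) := by rw [h]; ring
    _ = star (a G + b G * Zᴴ).det * (c G * Z + d G).det * (1 - I • Φ Z).det * 2 ^ Fintype.card (α ⊕ β) := by
          rw [h1]

end UnitaryBall

end Literature.NumberTheory.Weil1964
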